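import Summits.QuantumFields.BalabanUV.Beta.FP.CovarianceGaugeFactor
import Literature.MathematicalPhysics.QuantumFieldTheory.Balaban1983to89.B5G115RowSum

/-!
# `BalabanUV.Beta.FP.CovarianceRowSum` — road «FP» (binder row D1), lane IR-5′, **THE (T0′) SUPPLIER CHAIN, FILE 2: THE ROW-SUM (`ℓ^∞ → ℓ^∞`)
# LETTER OF THE HARD COVARIANCE FROM THREE LETTERS** — `Σ_j ‖𝒞 i j‖ ≤ c_G + c_A·c_B + c_G·c_C·c_G` from the row-sum letters of `G` (pv15),
# of the two coarse-projected free gradient kernels `∂Δ⁻¹R`, `RΔ⁻¹∂ᴴ` (scalar `G′`, files 3), and of the constraint sandwich `Q*(QGQ*)⁻¹Q`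
# (our bookkeeping: generic row-sum algebra + `CovarianceGaugeFactor.Cov_eq_free_gauge` BY NAME; no estimate is proved here)

HONEST DEPENDENCY (page 1, mandatory): continuum YM on T⁴ ⇐ BetaPertH ∧ nine spine estimates (0/9 proved); BetaPertH ⇐ (D1) ∧ (D4) ∧
CAP+tail; G-an2-4 gates asym, D1 and NE2/3/4.  HONEST FRAMING (cell contract, verbatim): «discharging `BetaPertH` makes Bałaban's UV
stability UNCONDITIONAL — a real constructive-QFT result; it is NOT the continuum limit and NOT the Clay problem.»  THIS MODULE is generic [folklore]
row-sum algebra for finite matrices over `ℂ` (§1) and its reading on `CovarianceGaugeFactor.Cov_eq_free_gauge` (§2): every analytic input — the four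
row-sum letters — is a HYPOTHESIS displayed in the signature.  It cites nothing, mints no `Prop`, has no `def`, 0 sorry.  NOT (T0′) (the letters are
files 3–4 of the chain: `‖G‖` = pv15 `B5G115SupBound`, `‖(QGQ*)⁻¹‖` = Δ_k + a, `‖RΔ⁻¹∂ᴴ‖`∕`‖∂Δ⁻¹R‖` = scalar G′ entries of lit-balaban
`B5Prop12GpTorus.gp_blocks_top′` through `B5GreenBridgeP12Dict`, and `‖PcT‖_{∞→∞}`), NOT hslice, NOT (ASYMP), NOT D1, NOT BetaPertH, NOT continuum, NOT Clay.

ABSOLUTE RULE (cell charter, verbatim): «No internally-minted statement may enter as a cited fact. Every hypothesis is either kernel-proved in this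
package or a verbatim quotation of a PUBLISHED theorem with page reference. The manuscript(s) under audit are NOT citable for their own disputed
steps — they are the thing under adjudication; programme-internal (2001/route/tribunal) claims are never citable.»

CONTENT.  §1 `rowSum_mul_le` (`Σ_k ‖(A·B) i k‖ ≤ a·b` from row-sum letters `a`, `b`), `rowSum_sub_le`, `rowSum_nonneg_of_le`, **`rowSum_le_of_decomp`**
(`X = G − A·B − G·C·G`); §3 **`rowSum_Cov_one_le`** (a = 1, `cG` DISCHARGED by pv15's
`B5G115RowSum.sum_norm_DeltaA_one_inv_le`); §2 **`rowSum_Cov_le`**: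
for the torus operators of `Beta.FluctuationProjection` (`𝒞 = Cov n hn M a ha`), from `hG : ∀ i, Σ_j ‖calG i j‖ ≤ cG`, `hA : ∀ i, Σ_j ‖(∂·Δ⁻¹·R) i j‖ ≤ cA`,
`hB : ∀ i, Σ_j ‖(R·Δ⁻¹·∂ᴴ) i j‖ ≤ cB`, `hC : ∀ i, Σ_j ‖(Q*·(QGQ*)⁻¹·Q) i j‖ ≤ cC` conclude **`∀ i, Σ_j ‖𝒞 i j‖ ≤ cG + cA·cB + cG·cC·cG`** — the shape
(T0′)'s road reading consumes (`FF-LEG-LETTERS.md` v2 §4: `‖Γ_m‖_{∞→∞} = ½n²·M^{4−D}·‖𝒞‖_{∞→∞}`).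
Unit `b2b-balaban-beta-d1-formalise-leaf-05` (gen 18), 2026-08-21; `LEAVES-FP.md` row «(T0′) CHAIN FILE 2».  «not in print; our bookkeeping».
-/

noncomputable section

open scoped BigOperators Matrix ComplexConjugate

namespace Summit.QuantumFields.BalabanUV.Beta.FP.CovarianceRowSum

open Literature.MathematicalPhysics.QuantumFieldTheory.Balaban1983to89
open Literature.MathematicalPhysics.QuantumFieldTheory.Balaban1983to89.B5Prop11Plancherel (Tor fine calG)
open Literature.MathematicalPhysics.QuantumFieldTheory.Balaban1983to89.B5Action121 (GradOp)
open Literature.MathematicalPhysics.QuantumFieldTheory.Balaban1983to89.B5Block118 (QvOp)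
open Literature.MathematicalPhysics.QuantumFieldTheory.Balaban1983to89.B5LaplaceInverse (LapSinv)
open Literature.MathematicalPhysics.QuantumFieldTheory.Balaban1983to89.B5DeltaA169 (QvAdj)
open Literature.MathematicalPhysics.QuantumFieldTheory.Balaban1983to89.B5Identities197Torus (RT)
open Literature.MathematicalPhysics.QuantumFieldTheory.Balaban1983to89.Beta.FluctuationProjection (Cov QGQ)
open Literature.MathematicalPhysics.QuantumFieldTheory.Balaban1983to89.B4TorusKernel (periodConst)
open Literature.MathematicalPhysics.QuantumFieldTheory.Balaban1983to89.B5G183Strip (kappa183)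
open Literature.MathematicalPhysics.QuantumFieldTheory.Balaban1983to89.B5G183CovDecay (MD183)
open Literature.MathematicalPhysics.QuantumFieldTheory.Balaban1983to89.B4Sect5Proof (latticeConst)
open Literature.MathematicalPhysics.QuantumFieldTheory.Balaban1983to89.B5DeltaA169 (calG_eq_DeltaA_inv)
open Literature.MathematicalPhysics.QuantumFieldTheory.Balaban1983to89.B5G115RowSum (sum_norm_DeltaA_one_inv_le)
open Summit.QuantumFields.BalabanUV.Beta.FP.CovarianceGaugeFactor (Cov_eq_free_gauge')

/-! ## §1 Row-sum algebra -/

section RowSum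

variable {ι κ μ : Type*} [Fintype κ] [Fintype μ]

/-- [folklore] a row-sum letter forces its constant nonnegative (when the index type is inhabited by the row in question). -/
theorem rowSum_nonneg_of_le {A : Matrix ι κ ℂ} {a : ℝ} (i : ι) (hA : ∑ j, ‖A i j‖ ≤ a) : 0 ≤ a :=
  le_trans (Finset.sum_nonneg fun _ _ => norm_nonneg _) hA

/-- [folklore] **ROW SUMS OF A PRODUCT**: `Σ_k ‖(A·B) i k‖ ≤ (Σ_j ‖A i j‖)·b` whenever every row sum of `B` is `≤ b`. -/
theorem rowSum_mul_le_row {A : Matrix ι κ ℂ} {B : Matrix κ μ ℂ} {b : ℝ} (hB : ∀ j, ∑ k, ‖B j k‖ ≤ b) (i : ι) :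
    ∑ k, ‖(A * B) i k‖ ≤ (∑ j, ‖A i j‖) * b := by
  calc ∑ k, ‖(A * B) i k‖ = ∑ k, ‖∑ j, A i j * B j k‖ := by simp only [Matrix.mul_apply]
    _ ≤ ∑ k, ∑ j, ‖A i j‖ * ‖B j k‖ := Finset.sum_le_sum fun k _ => (norm_sum_le _ _).trans (by simp only [norm_mul]; exact le_rfl)
    _ = ∑ j, ‖A i j‖ * ∑ k, ‖B j k‖ := by rw [Finset.sum_comm]; simp only [Finset.mul_sum]
    _ ≤ ∑ j, ‖A i j‖ * b := Finset.sum_le_sum fun j _ => mul_le_mul_of_nonneg_left (hB j) (norm_nonneg _)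
    _ = (∑ j, ‖A i j‖) * b := by rw [Finset.sum_mul]

/-- [folklore] **ROW-SUM LETTERS MULTIPLY**: `Σ_k ‖(A·B) i k‖ ≤ a·b`. -/
theorem rowSum_mul_le {A : Matrix ι κ ℂ} {B : Matrix κ μ ℂ} {a b : ℝ} (hA : ∀ i, ∑ j, ‖A i j‖ ≤ a) (hB : ∀ j, ∑ k, ‖B j k‖ ≤ b)
    [Nonempty κ] (i : ι) : ∑ k, ‖(A * B) i k‖ ≤ a * b := by
  have hb : 0 ≤ b := rowSum_nonneg_of_le (Classical.arbitrary κ) (hB _)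
  exact (rowSum_mul_le_row hB i).trans (mul_le_mul_of_nonneg_right (hA i) hb)

/-- [folklore] row-sum letters subtract (triangle inequality). -/
theorem rowSum_sub_le {A B : Matrix ι κ ℂ} {a b : ℝ} (hA : ∀ i, ∑ j, ‖A i j‖ ≤ a) (hB : ∀ i, ∑ j, ‖B i j‖ ≤ b) (i : ι) :
    ∑ j, ‖(A - B) i j‖ ≤ a + b := by
  calc ∑ j, ‖(A - B) i j‖ ≤ ∑ j, (‖A i j‖ + ‖B i j‖) := Finset.sum_le_sum fun j _ => by
        rw [Matrix.sub_apply]; exact norm_sub_le _ _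
    _ = ∑ j, ‖A i j‖ + ∑ j, ‖B i j‖ := Finset.sum_add_distrib
    _ ≤ a + b := add_le_add (hA i) (hB i)

/-- [folklore] **ROW SUMS OF `X = G − A·B − G·C·G`**: `Σ_j ‖X i j‖ ≤ cG + cA·cB + cG·cC·cG` from the four row-sum letters. -/
theorem rowSum_le_of_decomp [Fintype ι] [Nonempty ι] [Nonempty κ] {G C X : Matrix ι ι ℂ} {A : Matrix ι κ ℂ} {B : Matrix κ ι ℂ}
    {cG cA cB cC : ℝ} (hX : X = G - A * B - G * C * G)
    (hG : ∀ i, ∑ j, ‖G i j‖ ≤ cG) (hA : ∀ i, ∑ j, ‖A i j‖ ≤ cA) (hB : ∀ i, ∑ j, ‖B i j‖ ≤ cB) (hC : ∀ i, ∑ j, ‖C i j‖ ≤ cC) (i : ι) :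
    ∑ j, ‖X i j‖ ≤ cG + cA * cB + cG * cC * cG := by
  rw [hX]
  have hAB := rowSum_mul_le hA hB
  have hGC : ∀ i, ∑ j, ‖(G * C) i j‖ ≤ cG * cC := rowSum_mul_le hG hC
  have hGCG := rowSum_mul_le hGC hG
  have h1 := rowSum_sub_le hG hAB
  have h2 := rowSum_sub_le h1 hGCG i
  linarith

end RowSum

/-! ## §2 The hard covariance's row-sum letter from four letters -/

section Cov

variable {d : ℕ} (n : ℕ) [NeZero n] (hn : 1 ≤ n) (M : Fin d → ℕ) [hM : ∀ μ, NeZero (M μ)] (a : ℝ) (ha : 0 < a)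

/-- [our bookkeeping] **THE ROW-SUM LETTER OF `𝒞` FROM FOUR LETTERS** (`CovarianceGaugeFactor.Cov_eq_free_gauge'`): with `G = calG`, `A = ∂·Δ⁻¹·R`,
`B = R·Δ⁻¹·∂ᴴ`, `C = Q*·(QGQ*)⁻¹·Q`: `Σ_j ‖𝒞 i j‖ ≤ cG + cA·cB + cG·cC·cG` for every row `i`. -/
theorem rowSum_Cov_le {cG cA cB cC : ℝ}
    (hG : ∀ i, ∑ j, ‖calG n hn M a ha i j‖ ≤ cG)
    (hA : ∀ i, ∑ j, ‖(GradOp (fine n M) (n : ℂ) * LapSinv (fine n M) (n : ℂ) * RT n M) i j‖ ≤ cA)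
    (hB : ∀ i, ∑ j, ‖(RT n M * LapSinv (fine n M) (n : ℂ) * (GradOp (fine n M) (n : ℂ))ᴴ) i j‖ ≤ cB)
    (hC : ∀ i, ∑ j, ‖(QvAdj n M * (QGQ n hn M a ha)⁻¹ * QvOp n M) i j‖ ≤ cC)
    (i : Tor (fine n M) × Fin d) :
    ∑ j, ‖Cov n hn M a ha i j‖ ≤ cG + cA * cB + cG * cC * cG := by
  haveI : Nonempty (Tor (fine n M) × Fin d) := ⟨i⟩
  haveI : Nonempty (Tor (fine n M)) := ⟨i.1⟩
  exact rowSum_le_of_decomp (Cov_eq_free_gauge' n hn M a ha) hG hA hB hC i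

end Cov

/-! ## §3 At `a = 1` the letter `cG` is in the tree (pv15): one letter down -/

section One

variable {d : ℕ} (n : ℕ) [NeZero n] (hn : 1 ≤ n) (M : Fin (d + 1) → ℕ) [hM : ∀ μ, NeZero (M μ)]

/-- [our bookkeeping] **THE ROW-SUM LETTER OF `𝒞` WITH `cG` DISCHARGED** (`a = 1`; `𝒞` does not depend on `a`, `FluctuationProjection.Cov_indep`):
pv15's `B5G115RowSum.sum_norm_DeltaA_one_inv_le` supplies `cG = C(d,N)` (any `N ≥ d`), UNIFORMLY in `n` and in the torus; the three remaining
letters `cA cB cC` stay displayed. -/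
theorem rowSum_Cov_one_le {Nn : ℕ} (hN : d + 1 ≤ Nn + 1) {cA cB cC : ℝ}
    (hA : ∀ i, ∑ j, ‖(GradOp (fine n M) (n : ℂ) * LapSinv (fine n M) (n : ℂ) * RT n M) i j‖ ≤ cA)
    (hB : ∀ i, ∑ j, ‖(RT n M * LapSinv (fine n M) (n : ℂ) * (GradOp (fine n M) (n : ℂ))ᴴ) i j‖ ≤ cB)
    (hC : ∀ i, ∑ j, ‖(QvAdj n M * (QGQ n hn M 1 one_pos)⁻¹ * QvOp n M) i j‖ ≤ cC)
    (i : Tor (fine n M) × Fin (d + 1)) :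
    ∑ j, ‖Cov n hn M 1 one_pos i j‖
      ≤ (2 * Nn * 2 ^ Nn * Real.exp (1 / (2 * (d + 1))) * latticeConst (d + 1) (1 / (2 * (d + 1)))
          + (d + 1) * (MD183 (d + 1) Nn * periodConst (kappa183 (d + 1)) d * latticeConst (d + 1) (kappa183 (d + 1) / (d + 1))))
        + cA * cB
        + (2 * Nn * 2 ^ Nn * Real.exp (1 / (2 * (d + 1))) * latticeConst (d + 1) (1 / (2 * (d + 1)))
          + (d + 1) * (MD183 (d + 1) Nn * periodConst (kappa183 (d + 1)) d * latticeConst (d + 1) (kappa183 (d + 1) / (d + 1))))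
          * cC
          * (2 * Nn * 2 ^ Nn * Real.exp (1 / (2 * (d + 1))) * latticeConst (d + 1) (1 / (2 * (d + 1)))
          + (d + 1) * (MD183 (d + 1) Nn * periodConst (kappa183 (d + 1)) d * latticeConst (d + 1) (kappa183 (d + 1) / (d + 1)))) := by
  have hG : ∀ i : Tor (fine n M) × Fin (d + 1), ∑ j, ‖calG n hn M 1 one_pos i j‖
      ≤ 2 * Nn * 2 ^ Nn * Real.exp (1 / (2 * (d + 1))) * latticeConst (d + 1) (1 / (2 * (d + 1)))
          + (d + 1) * (MD183 (d + 1) Nn * periodConst (kappa183 (d + 1)) d * latticeConst (d + 1) (kappa183 (d + 1) / (d + 1))) := by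
    intro i'
    rw [calG_eq_DeltaA_inv]
    exact sum_norm_DeltaA_one_inv_le n hn M hN i'
  exact rowSum_Cov_le n hn M 1 one_pos hG hA hB hC i

end One

end Summit.QuantumFields.BalabanUV.Beta.FP.CovarianceRowSum

end
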